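import Literature.MathematicalPhysics.QuantumFieldTheory.Balaban1983to89.BlockAveragingHaarAC
import Literature.MathematicalPhysics.QuantumFieldTheory.Balaban1983to89.BlockAveragingExpMeanLog
import Literature.MathematicalPhysics.QuantumFieldTheory.Balaban1983to89.T4EMLFibreAC

/-!
# `HaarAC` for Bałaban's block averaging (0.4) with the PRINTED exp-mean-log average on `SU(2)`

`BlockAveragingHaarAC` proved the measure-theoretic residual `HaarAC` of `T4FiniteEpsInhabited` (the push-forward of product
Haar measure under the averaging function `Ū = M(U, ·) : T^{(j)} → T^{(j+1)}` is absolutely continuous) for the block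
averaging (0.4) of [Balaban1987RG1] p. 253 driven by the quaternionic projected mean `su2Mean`.  This module proves it for
(0.4) driven by the PRINTED small-loop average `ExpMeanLog.expMeanLogSU` — `exp[i Σ_i |I|⁻¹ (1/i) log W_i]` with the series
logarithm `MatrixLog.mlog`, guarded by `‖W_i − 1‖ < δ_N = min(1/3, π/N)`, value `1` off the guard — on `SU(2)`
(`haarAC_avgFun_expMeanLogSU`), and draws the inhabitation corollary (`exists_isBlockAveraged_expMeanLogSU`).  It is the
ASSEMBLY of the cell's off-spine node T4-D.G-EML: the architecture of `BlockAveragingHaarAC` §4 (private coordinates +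
triangular push-forward) re-run for a GENERAL small-loop average up to ONE one-variable input (§1), the identification of that
input for the exp-mean-log average on `SU(N)` (§2), and its discharge on `SU(2)` by the fibre lemma of `T4EMLFibreAC`
(`T4EMLFibreAC.haarData_restrict_map_absolutelyContinuous_expMeanLog`, built on `T4QuatExpLog` and `T4HaarSU2LocalDiffeo`) (§3).

## The argument

§1 (every group `G`, every small-loop average `ℰ`).  In the private coordinate `g = U(β(c))` of `BlockAveragingHaarAC` (FACTS
(A), (B) there) put `W := U′(c) = pre · g · post` (`BlockAveragingHaarAC.axialAvg_update_centralBond`), a two-sided translate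
of `g`.  The loop variables of (0.4) at `c` become `V_i · W⁻¹` at the off-central indices (`V_i` = the open holonomy
`BlockAveragingHaarAC.openHol`, free of `g`) and `1` at the central ones: the W-COORDINATE FAMILY `fibreFamily`
(`loopHol_update_centralBond_self`).  Hence `Ū′(c) = fibreMap W` (`avgFun_update_centralBond_self`) with
`fibreMap W = ℰ.avg (fibreFamily W) · W` on the guard `fibreGuard = {W | ∀ i, dist1 (fibreFamily W i) < δ}` and `fibreMap W = W`
off it.  Haar measure is two-sidedly invariant (`map_haar_mul_mul`), so the one-variable law of `Ū′(c)` in `g` is the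
push-forward of Haar measure under `fibreMap` (`map_haar_avgFun_update_eq`); and a measurable map that is the identity off a
set `S` pushes `μ` forward to an absolutely continuous measure as soon as `(μ.restrict S).map f ≪ μ`
(`absolutelyContinuous_map_of_restrict`).  With the locality of `Ū` and the injectivity of `β`
(`BlockAveragingHaarAC.isLocal_avgFun`, `BlockAveragingHaarAC.centralBond_injective`) the triangular push-forward lemma
`T4TriangularPushforward.map_pi_absolutelyContinuous_pi` reduces `HaarAC (avgFun ℰ)` to the absolute continuity of the
GUARDED FIBRE LAWS `((Haar).restrict fibreGuard).map (W ↦ ℰ.avg (fibreFamily W) · W)` (`haarAC_avgFun_of_guard`).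

§2 (`SU(N)`, `ℰ = expMeanLogSU`).  On the guard the average IS the printed exponential (`coe_avg_expMeanLogSU`; reindexing
invariance `eml_comp_equiv'`), the central terms vanish (`log 1 = 0`) and `V_i W⁻¹ = V_i W*`, so the guarded fibre map is
`W ↦ exp(Σ_k |I|⁻¹ log(h_k W*)) · W` over the `m = |I| − N_c < |I|` off-central indices (`coe_fibreCore_eq`,
`offCard_lt_card`: weights `|I|⁻¹ ≥ 0` of total `m/|I| < 1`, `sum_emlWeight_lt_one`), with `‖h_k W* − 1‖ < δ_N ≤ 1/3` on the
guard (`norm_offHol_mul_star_sub_one_lt`); and the guard is open (`isOpen_fibreGuard`).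

§3 (`SU(2)`).  These are exactly the hypotheses of `T4EMLFibreAC.haarData_restrict_map_absolutelyContinuous_expMeanLog`
(`haar_restrict_fibreGuard_map_absolutelyContinuous`), whence `HaarAC` on every torus in the standing range
(`haarAC_avgFun_expMeanLogSU_of_le`, `haarAC_avgFun_expMeanLogSU`) and the inhabitation corollaries.

## What this is NOT

As in `BlockAveragingHaarAC`: the corollary `exists_isBlockAveraged_expMeanLogSU` inhabits the CARRIER `FiniteEpsData F SU(2)`
with data averaging by the printed (0.4); the inhabitant is the STUB of `T4FiniteEpsInhabited` §3 (placeholder `Realisation`),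
at which the pinned end statement (B) of the cell FAILS (`T4FiniteEpsInhabited.not_endStatementBPrinted_of_stubData`).
Nothing here is progress on the continuum limit (Theorems 1–2 of [Balaban1987RG1]) or on the summit: the node is OFF the spine
of the cell's T4 DAG, and every result is elementary measure theory ([folklore]) about the published formula (0.4) p. 253.
`SU(N)` for `N ≥ 3` is not treated (the fibre lemma of `T4EMLFibreAC` is quaternionic); §§1–2 hold for every group, resp. every
`SU(N)`, and isolate the single `SU(N)` input that would be needed.

## Versions

* v1: the module.
-/

noncomputable section

open MeasureTheory Function NormedSpace

namespace Literature.MathematicalPhysics.QuantumFieldTheory.Balaban1983to89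

namespace BlockAveragingEMLHaarAC

open T4Continuum AveragingRT BlockAveraging BlockAveragingHaarAC

/-! ## 1. Every group, every small-loop average: the W-coordinate normal form and the reduction to guarded fibre laws -/

section Fibre

variable {P : Params} {j : ℕ} {G : Type*} [GaugeGroup G]

/-- **THE W-COORDINATE FAMILY** at `c`: `1` at the central indices, `V_i · W⁻¹` (open holonomy times the inverse of the
coarse bond variable `W = U′(c)`) at the off-central ones. [folklore] -/
def fibreFamily (U : GaugeField P j G) (c : PBond P (j+1)) (W : G) (i : Idx P) : G :=
  if IsCentral c i then 1 else openHol U c i * W⁻¹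

/-- At a central index the W-coordinate family is `1`. [folklore] -/
theorem fibreFamily_of_isCentral (U : GaugeField P j G) (c : PBond P (j+1)) (W : G) (i : Idx P) (h : IsCentral c i) :
    fibreFamily U c W i = 1 := by
  unfold fibreFamily; rw [if_pos h]

/-- At an off-central index the W-coordinate family is `V_i · W⁻¹`. [folklore] -/
theorem fibreFamily_of_not_isCentral (U : GaugeField P j G) (c : PBond P (j+1)) (W : G) (i : Idx P) (h : ¬ IsCentral c i) :
    fibreFamily U c W i = openHol U c i * W⁻¹ := by
  unfold fibreFamily; rw [if_neg h]

/-- **THE LOOP VARIABLES OF (0.4) IN THE PRIVATE COORDINATE**: for `U′ = U[β(c) ↦ g]` the family of loop variables at `c` is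
the W-coordinate family at `W = U′(c) = pre · g · post` (FACTS (A), (B) of `BlockAveragingHaarAC`). [folklore] -/
theorem loopHol_update_centralBond_self [DecidableEq (PBond P j)] (hj : j + 1 ≤ P.m + P.K) (U : GaugeField P j G)
    (c : PBond P (j+1)) (g : G) : loopHol (update U (centralBond c) g) c = fibreFamily U c (pre U c * g * post U c) := by
  funext i
  rw [loopHol_eq_openHol_mul, axialAvg_update_centralBond hj]
  by_cases h : IsCentral c i
  · rw [fibreFamily_of_isCentral U c _ i h, openHol_of_isCentral _ c i h, axialAvg_update_centralBond hj, mul_inv_cancel]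
  · rw [fibreFamily_of_not_isCentral U c _ i h, openHol_update_of_not_isCentral hj U c i h g]

/-- The small-field guard in the W-coordinate. [folklore] -/
def FibreSmall (ℰ : LoopAverage G) (U : GaugeField P j G) (c : PBond P (j+1)) (W : G) : Prop :=
  ∀ i, dist1 (fibreFamily U c W i) < ℰ.δ

/-- The small-field guard in the W-coordinate, as a set. [folklore] -/
def fibreGuard (ℰ : LoopAverage G) (U : GaugeField P j G) (c : PBond P (j+1)) : Set G :=
  {W | FibreSmall ℰ U c W}

open scoped Classical in
/-- **THE FIBRE MAP** `W ↦ Ū′(c)`: `ℰ.avg (fibreFamily W) · W` on the guard, `W` off it. [folklore] -/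
def fibreMap (ℰ : LoopAverage G) (U : GaugeField P j G) (c : PBond P (j+1)) (W : G) : G :=
  (if FibreSmall ℰ U c W then ℰ.avg (fibreFamily U c W) else 1) * W

/-- The guard of (0.4) at `U′ = U[β(c) ↦ g]` is the W-coordinate guard at `W = pre · g · post`. [folklore] -/
theorem small_update_centralBond_self_iff [DecidableEq (PBond P j)] (hj : j + 1 ≤ P.m + P.K) (ℰ : LoopAverage G)
    (U : GaugeField P j G) (c : PBond P (j+1)) (g : G) :
    Small ℰ (update U (centralBond c) g) c ↔ FibreSmall ℰ U c (pre U c * g * post U c) := by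
  unfold BlockAveraging.Small FibreSmall
  rw [loopHol_update_centralBond_self hj]

/-- **THE ONE-VARIABLE NORMAL FORM OF (0.4)**: `Ū′(c) = fibreMap (pre · g · post)` for `U′ = U[β(c) ↦ g]`, for every
small-loop average. [folklore] -/
theorem avgFun_update_centralBond_self [DecidableEq (PBond P j)] (hj : j + 1 ≤ P.m + P.K) (ℰ : LoopAverage G)
    (U : GaugeField P j G) (c : PBond P (j+1)) (g : G) :
    avgFun ℰ (update U (centralBond c) g) c = fibreMap ℰ U c (pre U c * g * post U c) := by
  show corr ℰ _ c * axialAvg _ c = _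
  unfold corr fibreMap
  rw [small_update_centralBond_self_iff hj, loopHol_update_centralBond_self hj, axialAvg_update_centralBond hj]

/-- On the guard the fibre map is `ℰ.avg (fibreFamily W) · W`. [folklore] -/
theorem fibreMap_of_mem (ℰ : LoopAverage G) (U : GaugeField P j G) (c : PBond P (j+1)) {W : G} (hW : W ∈ fibreGuard ℰ U c) :
    fibreMap ℰ U c W = ℰ.avg (fibreFamily U c W) * W := by
  have h : FibreSmall ℰ U c W := hW
  unfold fibreMap; rw [if_pos h]

/-- Off the guard the fibre map is the identity. [folklore] -/
theorem fibreMap_of_not_mem (ℰ : LoopAverage G) (U : GaugeField P j G) (c : PBond P (j+1)) {W : G}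
    (hW : W ∉ fibreGuard ℰ U c) : fibreMap ℰ U c W = W := by
  have h : ¬ FibreSmall ℰ U c W := hW
  unfold fibreMap; rw [if_neg h, one_mul]

/-- The number `m = |I| − N_c` of off-central indices at `c`. [folklore] -/
def offCard (c : PBond P (j+1)) : ℕ := Fintype.card {i : Idx P // ¬ IsCentral c i}

/-- A fixed enumeration of the off-central indices by `Fin m`. [folklore] -/
def offEquiv (c : PBond P (j+1)) : {i : Idx P // ¬ IsCentral c i} ≃ Fin (offCard c) := Fintype.equivFin _

/-- `m < |I|` (there is a central index, `BlockAveragingHaarAC.nCentral_pos`). [folklore] -/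
theorem offCard_lt_card (c : PBond P (j+1)) : offCard c < Fintype.card (Idx P) := by
  obtain ⟨i₀, hi₀⟩ := Finset.card_pos.mp (nCentral_pos c)
  exact Fintype.card_subtype_lt (p := fun i => ¬ IsCentral c i) (not_not.mpr (Finset.mem_filter.mp hi₀).2)

/-- The enumerated off-central open holonomies `h_k = V_{i(k)}`. [folklore] -/
def offHol (U : GaugeField P j G) (c : PBond P (j+1)) (k : Fin (offCard c)) : G := openHol U c ((offEquiv c).symm k).1

/-- The uniform weight `|I|⁻¹` of (0.4). [folklore] -/
def emlWeight (P : Params) : ℝ := ((Fintype.card (Idx P) : ℝ))⁻¹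

/-- `|I|⁻¹ ≥ 0`. [folklore] -/
theorem emlWeight_nonneg (P : Params) : 0 ≤ emlWeight P := inv_nonneg.mpr (Nat.cast_nonneg _)

/-- The total weight of the off-central indices is `m/|I| < 1`. [folklore] -/
theorem sum_emlWeight_lt_one (c : PBond P (j+1)) : ∑ _k : Fin (offCard c), emlWeight P < 1 := by
  rw [Finset.sum_const, Finset.card_univ, Fintype.card_fin, nsmul_eq_mul, emlWeight, ← div_eq_mul_inv,
    div_lt_one (Nat.cast_pos.mpr Fintype.card_pos)]
  exact_mod_cast offCard_lt_card c

end Fibre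

section Meas

variable {P : Params} {j : ℕ} {G : Type*} [GaugeGroup G] [MeasurableSpace G] [RegularGaugeGroup G]

/-- The W-coordinate family is measurable in `W`. [folklore] -/
theorem measurable_fibreFamily (U : GaugeField P j G) (c : PBond P (j+1)) : Measurable (fibreFamily U c) := by
  refine measurable_pi_lambda _ fun i => ?_
  by_cases h : IsCentral c i
  · simp only [fibreFamily, if_pos h]
    exact measurable_const
  · simp only [fibreFamily, if_neg h]
    exact measurable_const.mul measurable_inv

/-- The W-coordinate guard is measurable. [folklore] -/
theorem measurableSet_fibreGuard (ℰ : LoopAverage G) (U : GaugeField P j G) (c : PBond P (j+1)) :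
    MeasurableSet (fibreGuard ℰ U c) := by
  have : fibreGuard ℰ U c = ⋂ i, {W : G | dist1 (fibreFamily U c W i) < ℰ.δ} := by
    ext W; simp [fibreGuard, FibreSmall]
  rw [this]
  exact MeasurableSet.iInter fun i =>
    measurableSet_lt (RegularGaugeGroup.measurable_dist1.comp ((measurable_pi_apply i).comp (measurable_fibreFamily U c)))
      measurable_const

/-- The guarded branch `W ↦ ℰ.avg (fibreFamily W) · W` of the fibre map is measurable (given a measurable `ℰ`). [folklore] -/
theorem measurable_fibreCore (ℰ : LoopAverage G) (hE : ℰ.MeasurableE) (U : GaugeField P j G) (c : PBond P (j+1)) :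
    Measurable fun W : G => ℰ.avg (fibreFamily U c W) * W :=
  ((ℰ.measurable_avg hE).comp (measurable_fibreFamily U c)).mul measurable_id

/-- The fibre map is measurable (given a measurable `ℰ`). [folklore] -/
theorem measurable_fibreMap (ℰ : LoopAverage G) (hE : ℰ.MeasurableE) (U : GaugeField P j G) (c : PBond P (j+1)) :
    Measurable (fibreMap ℰ U c) := by
  show Measurable fun W => fibreMap ℰ U c W
  unfold fibreMap
  exact (Measurable.ite (measurableSet_fibreGuard ℰ U c) ((ℰ.measurable_avg hE).comp (measurable_fibreFamily U c))
    measurable_const).mul measurable_id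

end Meas

section Splice

variable {α : Type*} [MeasurableSpace α] {μ : Measure α}

/-- **SPLICE WITH THE IDENTITY.**  A measurable self-map `f` that is the identity off a set `S` pushes `μ` forward to an
absolutely continuous measure as soon as the restricted push-forward `(μ.restrict S).map f` is absolutely continuous:
`μ(f⁻¹N) ≤ μ(f⁻¹N ∩ S) + μ(N)`. [folklore] -/
theorem absolutelyContinuous_map_of_restrict {S : Set α} {f : α → α} (hf : Measurable f) (hoff : ∀ x, x ∉ S → f x = x)
    (hac : (μ.restrict S).map f ≪ μ) : μ.map f ≪ μ := by
  refine Measure.AbsolutelyContinuous.mk fun N hN hN0 => ?_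
  rw [Measure.map_apply hf hN]
  have h1 : μ (f ⁻¹' N ∩ S) = 0 := by
    rw [← Measure.restrict_apply (hf hN), ← Measure.map_apply hf hN]
    exact hac hN0
  refine measure_mono_null (fun x hx => ?_) (measure_union_null h1 hN0)
  by_cases hxS : x ∈ S
  · exact Or.inl ⟨hx, hxS⟩
  · rw [Set.mem_preimage, hoff x hxS] at hx
    exact Or.inr hx

end Splice

section Law

variable {P : Params} {j : ℕ} {G : Type*} [GaugeGroup G] [MeasurableSpace G] [RegularGaugeGroup G] [HaarData G]

/-- Haar measure is invariant under two-sided translations `g ↦ p g q`. [folklore] -/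
theorem map_haar_mul_mul (p q : G) : (HaarData.haar : Measure G).map (fun g => p * g * q) = HaarData.haar := by
  have hcomp : (fun g : G => p * g * q) = (fun g : G => g * q) ∘ (fun g : G => p * g) := rfl
  rw [hcomp, ← Measure.map_map (measurable_mul_const q) (measurable_const_mul p), HaarData.map_mul_left,
    HaarData.map_mul_right]

/-- **THE ONE-VARIABLE LAW OF (0.4) IS THE LAW OF THE FIBRE MAP**: the law of `Ū′(c)`, `U′ = U[β(c) ↦ g]`, under Haar
measure in `g` is the push-forward of Haar measure under `fibreMap`. [folklore] -/
theorem map_haar_avgFun_update_eq [DecidableEq (PBond P j)] (hj : j + 1 ≤ P.m + P.K) (ℰ : LoopAverage G)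
    (hE : ℰ.MeasurableE) (U : GaugeField P j G) (c : PBond P (j+1)) :
    (HaarData.haar : Measure G).map (fun g => avgFun ℰ (update U (centralBond c) g) c) =
      (HaarData.haar : Measure G).map (fibreMap ℰ U c) := by
  have h1 : (fun g => avgFun ℰ (update U (centralBond c) g) c) = fibreMap ℰ U c ∘ fun g => pre U c * g * post U c :=
    funext fun g => avgFun_update_centralBond_self hj ℰ U c g
  rw [h1, ← Measure.map_map (measurable_fibreMap ℰ hE U c) ((measurable_const_mul _).mul_const _), map_haar_mul_mul]

/-- The one-variable law of (0.4) is absolutely continuous as soon as the GUARDED FIBRE LAW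
`((Haar).restrict fibreGuard).map (W ↦ ℰ.avg (fibreFamily W) · W)` is. [folklore] -/
theorem map_haar_avgFun_update_absolutelyContinuous_of_guard [DecidableEq (PBond P j)] (hj : j + 1 ≤ P.m + P.K)
    (ℰ : LoopAverage G) (hE : ℰ.MeasurableE) (U : GaugeField P j G) (c : PBond P (j+1))
    (hac : ((HaarData.haar : Measure G).restrict (fibreGuard ℰ U c)).map (fun W => ℰ.avg (fibreFamily U c W) * W) ≪
      HaarData.haar) :
    (HaarData.haar : Measure G).map (fun g => avgFun ℰ (update U (centralBond c) g) c) ≪ HaarData.haar := by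
  rw [map_haar_avgFun_update_eq hj ℰ hE U c]
  refine absolutelyContinuous_map_of_restrict (measurable_fibreMap ℰ hE U c) (fun W hW => fibreMap_of_not_mem ℰ U c hW) ?_
  have heq : ((HaarData.haar : Measure G).restrict (fibreGuard ℰ U c)).map (fibreMap ℰ U c) =
      ((HaarData.haar : Measure G).restrict (fibreGuard ℰ U c)).map (fun W => ℰ.avg (fibreFamily U c W) * W) :=
    Measure.map_congr ((ae_restrict_iff' (measurableSet_fibreGuard ℰ U c)).mpr
      (ae_of_all _ fun W hW => fibreMap_of_mem ℰ U c hW))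
  rw [heq]
  exact hac

/-- **REDUCTION OF `HaarAC` TO THE GUARDED FIBRE LAWS** (every group, every measurable small-loop average), on every torus in
the standing range `j + 1 ≤ m + K`: if for every configuration `U` and coarse bond `c` the guarded fibre law
`((Haar).restrict fibreGuard).map (W ↦ ℰ.avg (fibreFamily U c W) · W)` is absolutely continuous, then the push-forward of
product Haar measure under `Ū = M(U, ·)` of (0.4) is absolutely continuous — by the triangular push-forward lemma of
`T4TriangularPushforward` in the private coordinates `β` of `BlockAveragingHaarAC`. [folklore] -/
theorem haarAC_avgFun_of_guard (hj : j + 1 ≤ P.m + P.K) (ℰ : LoopAverage G) (hE : ℰ.MeasurableE)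
    (hac : ∀ (U : GaugeField P j G) (c : PBond P (j+1)),
      ((HaarData.haar : Measure G).restrict (fibreGuard ℰ U c)).map (fun W => ℰ.avg (fibreFamily U c W) * W) ≪
        HaarData.haar) :
    T4FiniteEpsInhabited.HaarAC (avgFun ℰ : GaugeField P j G → GaugeField P (j+1) G) := by
  classical
  unfold T4FiniteEpsInhabited.HaarAC fieldMeasure
  exact T4TriangularPushforward.map_pi_absolutelyContinuous_pi (HaarData.haar : Measure G) (isLocal_avgFun hj ℰ)
    (centralBond_injective hj) (measurable_avgFun ℰ hE)
    (fun U c => map_haar_avgFun_update_absolutelyContinuous_of_guard hj ℰ hE U c (hac U c))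

end Law

/-! ## 2. `SU(N)`: the guarded fibre map of the exp-mean-log average is `W ↦ exp(Σ_k |I|⁻¹ log(h_k W*)) · W` -/

section SUN

open ExpMeanLog MatrixLog
open scoped Matrix.Norms.L2Operator

variable {P : Params} {j : ℕ} {n : Type*} [DecidableEq n] [Fintype n] [Nonempty n]

/-- Reindexing invariance of the printed operation along a bijection of index types (cf. `ExpMeanLog.eml_comp_equiv` for
permutations). [folklore] -/
theorem eml_comp_equiv' {𝔸 : Type*} [NormedRing 𝔸] [NormedAlgebra ℂ 𝔸] {ι ι' : Type*} [Fintype ι] [Fintype ι']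
    (W : ι → 𝔸) (e : ι' ≃ ι) : eml (W ∘ e) = eml W := by
  rw [eml_eq_exp, eml_eq_exp, Fintype.card_congr e,
    Fintype.sum_equiv e (fun k => mlog ((W ∘ e) k)) (fun i => mlog (W i)) fun k => rfl]

/-- **ON THE GUARD THE AVERAGE IS THE PRINTED EXPONENTIAL**: for a family `W : I → SU(N)` with `dist1 W_i < δ_N` for all `i`,
`expMeanLogSU.avg W = exp(|I|⁻¹ Σ_i log W_i)` (the fixed enumeration of `LoopAverage.avg` is immaterial).
[cite: Balaban1987RG1, (0.4) p.253] -/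
theorem coe_avg_expMeanLogSU {ι : Type*} [Fintype ι] [Nonempty ι] (W : ι → Matrix.specialUnitaryGroup n ℂ)
    (hW : ∀ i, dist1 (W i) < (expMeanLogSU (n := n)).δ) :
    (((expMeanLogSU (n := n)).avg W : Matrix.specialUnitaryGroup n ℂ) : Matrix n n ℂ) =
      exp (((Fintype.card ι : ℂ))⁻¹ • ∑ i, mlog (W i : Matrix n n ℂ)) := by
  have h' : ∀ k, ‖(((W ∘ (LoopAverage.enum ι).symm) k : Matrix.specialUnitaryGroup n ℂ) : Matrix n n ℂ) - 1‖ < deltaSU n :=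
    fun k => hW _
  show ((ESU (W ∘ (LoopAverage.enum ι).symm) : Matrix.specialUnitaryGroup n ℂ) : Matrix n n ℂ) = _
  rw [coe_ESU_of_small h', ← eml_eq_exp]
  exact eml_comp_equiv' (fun i => (W i : Matrix n n ℂ)) (LoopAverage.enum ι).symm

/-- In the matrix model, the off-central W-coordinate variable is `V_i W*`. [folklore] -/
theorem coe_fibreFamily_of_not_isCentral (U : GaugeField P j (Matrix.specialUnitaryGroup n ℂ)) (c : PBond P (j+1))
    (W : Matrix.specialUnitaryGroup n ℂ) (i : Idx P) (h : ¬ IsCentral c i) :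
    ((fibreFamily U c W i : Matrix.specialUnitaryGroup n ℂ) : Matrix n n ℂ) =
      ((openHol U c i : Matrix.specialUnitaryGroup n ℂ) : Matrix n n ℂ) * star (W : Matrix n n ℂ) := by
  rw [fibreFamily_of_not_isCentral U c W i h]; rfl

/-- In the matrix model, `dist1 (V_i W⁻¹) = ‖V_i W* − 1‖` at an off-central index. [folklore] -/
theorem dist1_fibreFamily_of_not_isCentral (U : GaugeField P j (Matrix.specialUnitaryGroup n ℂ)) (c : PBond P (j+1))
    (W : Matrix.specialUnitaryGroup n ℂ) (i : Idx P) (h : ¬ IsCentral c i) :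
    dist1 (fibreFamily U c W i) =
      ‖((openHol U c i : Matrix.specialUnitaryGroup n ℂ) : Matrix n n ℂ) * star (W : Matrix n n ℂ) - 1‖ := by
  rw [fibreFamily_of_not_isCentral U c W i h]; rfl

/-- **THE W-COORDINATE GUARD IS OPEN** in `SU(N)`. [folklore] -/
theorem isOpen_fibreGuard (U : GaugeField P j (Matrix.specialUnitaryGroup n ℂ)) (c : PBond P (j+1)) :
    IsOpen (fibreGuard (expMeanLogSU (n := n)) U c) := by
  have hδ := (expMeanLogSU (n := n)).δ_pos
  have hset : fibreGuard (expMeanLogSU (n := n)) U c =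
      ⋂ i, {W : Matrix.specialUnitaryGroup n ℂ | dist1 (fibreFamily U c W i) < (expMeanLogSU (n := n)).δ} := by
    ext W; simp [fibreGuard, FibreSmall]
  rw [hset]
  refine isOpen_iInter_of_finite fun i => ?_
  by_cases h : IsCentral c i
  · have huniv : {W : Matrix.specialUnitaryGroup n ℂ | dist1 (fibreFamily U c W i) < (expMeanLogSU (n := n)).δ} = Set.univ :=
      Set.eq_univ_of_forall fun W => by
        show dist1 (fibreFamily U c W i) < _
        rw [fibreFamily_of_isCentral U c W i h, GaugeGroup.dist1_one]; exact hδ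
    rw [huniv]; exact isOpen_univ
  · have hset' : {W : Matrix.specialUnitaryGroup n ℂ | dist1 (fibreFamily U c W i) < (expMeanLogSU (n := n)).δ} =
        {W : Matrix.specialUnitaryGroup n ℂ |
          ‖((openHol U c i : Matrix.specialUnitaryGroup n ℂ) : Matrix n n ℂ) * star (W : Matrix n n ℂ) - 1‖ <
            (expMeanLogSU (n := n)).δ} := by
      ext W; rw [Set.mem_setOf_eq, Set.mem_setOf_eq, dist1_fibreFamily_of_not_isCentral U c W i h]
    rw [hset']
    exact isOpen_lt ((continuous_const.mul continuous_subtype_val.star).sub continuous_const).norm continuous_const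

/-- The central terms drop out of the printed sum (`log 1 = 0`): `Σ_i log(fibreFamily W i) = Σ_k log(h_k W*)` over the
enumerated off-central indices. [folklore] -/
theorem sum_mlog_fibreFamily (U : GaugeField P j (Matrix.specialUnitaryGroup n ℂ)) (c : PBond P (j+1))
    (W : Matrix.specialUnitaryGroup n ℂ) :
    ∑ i, mlog ((fibreFamily U c W i : Matrix.specialUnitaryGroup n ℂ) : Matrix n n ℂ) =
      ∑ k : Fin (offCard c), mlog (((offHol U c k : Matrix.specialUnitaryGroup n ℂ) : Matrix n n ℂ) * star (W : Matrix n n ℂ)) := by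
  rw [← Fintype.sum_subtype_add_sum_subtype (IsCentral c)
    (fun i => mlog ((fibreFamily U c W i : Matrix.specialUnitaryGroup n ℂ) : Matrix n n ℂ))]
  have h0 : ∑ x : {i : Idx P // IsCentral c i},
      mlog ((fibreFamily U c W x : Matrix.specialUnitaryGroup n ℂ) : Matrix n n ℂ) = 0 :=
    Fintype.sum_eq_zero _ fun x => by rw [fibreFamily_of_isCentral U c W x x.2]; exact mlog_one
  rw [h0, zero_add]
  exact Fintype.sum_equiv (offEquiv c) _ _ fun x => by
    rw [coe_fibreFamily_of_not_isCentral U c W x x.2, offHol, Equiv.symm_apply_apply]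

/-- **THE GUARDED FIBRE MAP OF THE EXP-MEAN-LOG AVERAGE**: on the guard,
`expMeanLogSU.avg (fibreFamily W) · W = exp(Σ_k |I|⁻¹ log(h_k W*)) · W`. [cite: Balaban1987RG1, (0.4) p.253] -/
theorem coe_fibreCore_eq (U : GaugeField P j (Matrix.specialUnitaryGroup n ℂ)) (c : PBond P (j+1))
    {W : Matrix.specialUnitaryGroup n ℂ} (hW : W ∈ fibreGuard (expMeanLogSU (n := n)) U c) :
    (((expMeanLogSU (n := n)).avg (fibreFamily U c W) * W : Matrix.specialUnitaryGroup n ℂ) : Matrix n n ℂ) =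
      exp (∑ k : Fin (offCard c), ((emlWeight P : ℝ) : ℂ) •
          mlog (((offHol U c k : Matrix.specialUnitaryGroup n ℂ) : Matrix n n ℂ) * star (W : Matrix n n ℂ)))
        * (W : Matrix n n ℂ) := by
  have hw : ((emlWeight P : ℝ) : ℂ) = ((Fintype.card (Idx P) : ℂ))⁻¹ := by
    rw [emlWeight, Complex.ofReal_inv, Complex.ofReal_natCast]
  have hW' : ∀ i, dist1 (fibreFamily U c W i) < (expMeanLogSU (n := n)).δ := hW
  rw [hw, Submonoid.coe_mul, coe_avg_expMeanLogSU _ hW', sum_mlog_fibreFamily U c W, Finset.smul_sum]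

/-- On the guard, `‖h_k W* − 1‖ < 1/3` for every off-central `k` (`δ_N ≤ 1/3`). [folklore] -/
theorem norm_offHol_mul_star_sub_one_lt (U : GaugeField P j (Matrix.specialUnitaryGroup n ℂ)) (c : PBond P (j+1))
    {W : Matrix.specialUnitaryGroup n ℂ} (hW : W ∈ fibreGuard (expMeanLogSU (n := n)) U c) (k : Fin (offCard c)) :
    ‖((offHol U c k : Matrix.specialUnitaryGroup n ℂ) : Matrix n n ℂ) * star (W : Matrix n n ℂ) - 1‖ < 1 / 3 := by
  have hW' : ∀ i, dist1 (fibreFamily U c W i) < (expMeanLogSU (n := n)).δ := hW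
  have hi := hW' ((offEquiv c).symm k).1
  rw [dist1_fibreFamily_of_not_isCentral U c W _ ((offEquiv c).symm k).2] at hi
  exact lt_third_of_lt_deltaSU hi

end SUN

/-! ## 3. `SU(2)`: the guarded fibre laws are absolutely continuous (`T4EMLFibreAC`), hence `HaarAC` -/

section SU2

open ExpMeanLog MatrixLog
open scoped Matrix.Norms.L2Operator

variable {P : Params} {j : ℕ}

/-- **THE GUARDED FIBRE LAWS OF THE EXP-MEAN-LOG AVERAGE ON `SU(2)` ARE ABSOLUTELY CONTINUOUS** — the fibre lemma
`T4EMLFibreAC.haarData_restrict_map_absolutelyContinuous_expMeanLog` at the open guard, the off-central open holonomies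
`h_k`, the uniform weights `|I|⁻¹` of total `< 1`, and the normal form `coe_fibreCore_eq`. [folklore] -/
theorem haar_restrict_fibreGuard_map_absolutelyContinuous (U : GaugeField P j (Matrix.specialUnitaryGroup (Fin 2) ℂ))
    (c : PBond P (j+1)) :
    ((HaarData.haar : Measure (Matrix.specialUnitaryGroup (Fin 2) ℂ)).restrict (fibreGuard expMeanLogSU U c)).map
        (fun W => expMeanLogSU.avg (fibreFamily U c W) * W) ≪ HaarData.haar :=
  T4EMLFibreAC.haarData_restrict_map_absolutelyContinuous_expMeanLog (isOpen_fibreGuard U c) (offHol U c)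
    (c := fun _ => emlWeight P) (fun _ => emlWeight_nonneg P) (sum_emlWeight_lt_one c)
    (measurable_fibreCore expMeanLogSU measurable_expMeanLogSU_E U c)
    (fun W hW k => (norm_offHol_mul_star_sub_one_lt U c hW k).trans (by norm_num))
    (fun W hW => coe_fibreCore_eq U c hW)

/-- **`HaarAC` FOR BAŁABAN'S BLOCK AVERAGING (0.4) WITH THE PRINTED EXP-MEAN-LOG AVERAGE ON `SU(2)`**, on every torus in the
standing range `j + 1 ≤ m + K`: the push-forward of product Haar measure under `Ū = M(U, ·)` is absolutely continuous with
respect to product Haar measure — `HaarAC (avgFun expMeanLogSU)` on `GaugeField P j SU(2)` (stated in `@`-explicit form,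
which fixes the torus `P, j` and the group). [folklore] -/
theorem haarAC_avgFun_expMeanLogSU_of_le (hj : j + 1 ≤ P.m + P.K) :
    @T4FiniteEpsInhabited.HaarAC P j (Matrix.specialUnitaryGroup (Fin 2) ℂ) _ _ _ (avgFun expMeanLogSU) :=
  haarAC_avgFun_of_guard hj expMeanLogSU measurable_expMeanLogSU_E fun U c =>
    haar_restrict_fibreGuard_map_absolutelyContinuous U c

/-- **NODE T4-D.G-EML ON `SU(2)`: `HaarAC` ON EVERY TORUS OF A FAMILY** in the standing range `k < K` — the hypothesis of
`T4FiniteEpsInhabited.exists_isBlockAveraged_of_haarAC` for the printed average. [folklore] -/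
theorem haarAC_avgFun_expMeanLogSU (F : T4Family) (K k : ℕ) (hk : k < K) :
    @T4FiniteEpsInhabited.HaarAC (F.P K) k (Matrix.specialUnitaryGroup (Fin 2) ℂ) _ _ _ (avgFun expMeanLogSU) :=
  haarAC_avgFun_expMeanLogSU_of_le (by show k + 1 ≤ F.m + K; omega)

/-- **BLOCK-AVERAGED FINITE-`ε` DATA ON `SU(2)` WITH THE PRINTED AVERAGE EXIST**:
`∃ D : FiniteEpsData F SU(2), D.IsBlockAveraged expMeanLogSU`.  The inhabitant is the STUB of `T4FiniteEpsInhabited` §3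
(placeholder `Realisation`), at which the pinned end statement (B) FAILS
(`T4FiniteEpsInhabited.not_endStatementBPrinted_of_stubData`): carrier inhabitation, not the theorem.
[cite: Balaban1987RG1, (0.4) p.253] -/
theorem exists_isBlockAveraged_expMeanLogSU (F : T4Family) :
    ∃ D : T4Continuum.FiniteEpsData F (Matrix.specialUnitaryGroup (Fin 2) ℂ), D.IsBlockAveraged expMeanLogSU :=
  T4FiniteEpsInhabited.exists_isBlockAveraged_of_haarAC F (Matrix.specialUnitaryGroup (Fin 2) ℂ) expMeanLogSU
    measurable_expMeanLogSU_E (fun K k hk => haarAC_avgFun_expMeanLogSU F K k hk)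

/-- Hence finite-`ε` data on `SU(2)` averaging by (0.4) with the PRINTED small-loop average EXIST and satisfy the
reflection-positivity and torus-covariance targets in both forms (`T4Continuum.FiniteEpsData.limit_rp_and_cov_of_blockAvgEML`).
What is USED is the block-averaging formula (0.4) with its conjugation covariance (0.6) of [Balaban1987RG1] p. 253 together
with `HaarAC` (this module); Theorem 2 of [Balaban1987RG1] is NOT used, and the inhabitant is the STUB at which (B) fails.
[cite: Balaban1987RG1, (0.4) p.253] -/
theorem exists_blockAvgEML_rp_and_cov (F : T4Family) :
    ∃ D : T4Continuum.FiniteEpsData F (Matrix.specialUnitaryGroup (Fin 2) ℂ), D.IsBlockAveraged expMeanLogSU ∧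
      (D.limit_reflectionPositive' ∧ D.limit_reflectionPositive) ∧ (D.limit_torusCovariant' ∧ D.limit_torusCovariant) := by
  obtain ⟨D, hD⟩ := exists_isBlockAveraged_expMeanLogSU F
  exact ⟨D, hD, D.limit_rp_and_cov_of_blockAvgEML hD⟩

end SU2

end BlockAveragingEMLHaarAC

end Literature.MathematicalPhysics.QuantumFieldTheory.Balaban1983to89

end
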